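import Literature.AlgebraicGeometry.RealAlgebraic.RealPointsJacobian
import Literature.AlgebraicGeometry.Resolution.LogResolutionOfClosedSubset
import Literature.AlgebraicGeometry.Resolution.BlowupsFlatBaseChange
import Literature.AlgebraicGeometry.Resolution.SmoothOfRegularPerfectField
import Literature.AlgebraicGeometry.Motives.AbelianVarietyProofs
import Literature.AlgebraicGeometry.Resolution.AlterationsDimension
import HarnessLib

/-!
# Resolution data on the real points of a smooth real algebraic variety

Let `W` be a smooth, integral, separated `ℝ`-scheme of finite type and relative dimension `d`,
`W(ℝ)` its real-analytic manifold of real points (`RealAlgebraic/RealPointsManifold`), `e` the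
analytic algebraic chart at `Q₀ ∈ W(ℝ)`, and `s₁, …, s_l ∈ Γ(W, U)` non-zero regular functions on
an affine open `U ∋ Q₀`. Read in the chart, `Fᵢ = sᵢ ∘ e⁻¹` are real-analytic functions on the
open set `V = e(e.source ∩ U(ℝ)) ⊆ ℝᵈ`. The main theorem of this file,
`exists_resolutionData`, produces for them exactly the data asserted by **Hironaka's theorem on the
resolution of singularities in the form used for asymptotics of Laplace integrals**
(Arnold–Gusein-Zade–Varchenko II, §7.3, proof of Thm. 7.5; Atiyah 1970; Watanabe 2009, Thm. 2.8;
it is the hypothesis `hR` of the tree's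
`Literature.MathematicalPhysics.QuantumFieldTheory.localMonomialization_of_resolution`): a
real-analytic `d`-manifold `M`, a proper real-analytic map `g : M → V`, bijective off the zero
sets, and at every point of `M` over the zero set a chart of the maximal analytic atlas in which
every `Fᵢ ∘ g` is `(analytic unit) · monomial` and the Jacobian determinant of `g` is
`(analytic unit) · monomial`.

Construction: the tree PROVES Hironaka's log resolution for closed subsets of regular varieties
in characteristic zero (`Resolution.exists_logResolution_of_isClosed`, Kollár 2007 Thm. 3.21):
applied to `Z = ⋃ᵢ {sᵢ = 0}` it gives `Π : W' → W` proper, an isomorphism off `Z`, with `Π⁻¹Z` a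
simple normal crossings divisor; `M` is the open subset `Π(ℝ)⁻¹(e.source ∩ U(ℝ))` of the manifold
`W'(ℝ)` and `g = e ∘ Π(ℝ)`. Properness of `g` is the tree's `AlgPoints.isCompact_preimage_map`
(SGA 1 XII 3.2); the local normal forms at a real point `p` of `Π⁻¹Z` are read in the analytic
chart given by the regular system of parameters of the snc condition
(`RealPoints.exists_centredChart`), through the monomial normal form in the regular local ring
`𝒪_{W',p}` (`RealPoints.exists_mul_eq_mul_prod_pow`) — for the `Π^* sᵢ`, whose zeros lie on
`Π⁻¹Z`, and for the algebraic Jacobian determinant `J`, a unit wherever `Π` is a local isomorphism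
(`RealPoints.mem_basicOpen_det_of_isIso_stalkMap`), which computes the analytic Jacobian of `g`
(`RealPoints.det_fderiv_chart_map_eq_eval`).

Everything is proved; no named facts.

## References

* V. I. Arnold, S. M. Gusein-Zade, A. N. Varchenko, *Singularities of Differentiable Maps* II
  (2012), Part II §7.3, proof of Thm. 7.5; §6.3 Thm. 6.6. [ArnoldGuseinzadeVarchenko2012]
* M. F. Atiyah, *Resolution of singularities and division of distributions*, Comm. Pure Appl.
  Math. 23 (1970), 145–150.
* S. Watanabe, *Algebraic Geometry and Statistical Learning Theory* (2009), Thm. 2.8.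
  [WatanabeSumio2009]
* J. Kollár, *Lectures on Resolution of Singularities* (2007), Thm. 3.21. [Kollar2007]
-/

noncomputable section

open scoped Manifold ContDiff Topology Matrix
open CategoryTheory AlgebraicGeometry Filter Set KaehlerDifferential IsLocalRing
open Literature.AlgebraicGeometry.Motives
open Literature.AlgebraicGeometry.Motives.AlgPoints (evalOrZero evalOrZero_of_mem
  evalOrZero_of_not_mem)
open Literature.AlgebraicGeometry.Resolution

namespace Literature.AlgebraicGeometry.RealAlgebraic

namespace RealPoints

attribute [local instance] UniversalHyperplaneSection.sectionsAlgebra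

universe u

/-! ### Scheme-theoretic preliminaries -/

section Preliminaries

/-- A regular integral scheme locally of finite type over `ℝ` is smooth over `ℝ` of some relative
dimension (regular ⇒ smooth over a perfect field; the relative dimension of a smooth morphism
with irreducible source is constant). [cite: GortzWedhorn2020, Thm. 6.28 and Prop. 6.15] -/
theorem exists_smoothOfRelativeDimension_of_isRegular {W' : Scheme.{0}}
    (s : W' ⟶ Spec (.of ℝ)) [LocallyOfFiniteType s] [IsIntegral W'] (h : Scheme.IsRegular W') :
    ∃ d' : ℕ, SmoothOfRelativeDimension d' s := by
  haveI : Smooth s := smooth_of_isRegular_of_perfectField s h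
  exact Literature.AlgebraicGeometry.Motives.exists_smoothOfRelativeDimension_of_smooth s

variable {X X' : SchemeOver ℝ}

/-- **Relative dimensions agree at a point where the morphism is a local isomorphism.** If
`π : X' → X` is a morphism of `ℝ`-schemes smooth of relative dimensions `d'`, `d`, and at some
real point `P'` the stalk map `𝒪_{X,π P'} → 𝒪_{X',P'}` is an isomorphism, then `d' = d` (both are
the dimensions of the isomorphic local rings). [cite: GortzWedhorn2020, Lemma 6.26] -/
theorem eq_of_isIso_stalkMap {d d' : ℕ} [SmoothOfRelativeDimension d X.hom]
    [SmoothOfRelativeDimension d' X'.hom] (π : X' ⟶ X) (P' : AlgPoints X' ℝ)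
    [IsIso (π.left.stalkMap P'.pt)] : d' = d := by
  obtain ⟨V', hV', hP'V', hsm'⟩ :=
    AlgPoints.exists_isStandardSmoothOfRelativeDimension_scalarRingHom d' P'
  obtain ⟨V, hV, hPV, hsm⟩ :=
    AlgPoints.exists_isStandardSmoothOfRelativeDimension_scalarRingHom d (AlgPoints.map π P')
  have h' := ringKrullDim_stalk_eq_of_isStandardSmoothOfRelativeDimension hV' hsm' P' hP'V'
  have h := ringKrullDim_stalk_eq_of_isStandardSmoothOfRelativeDimension hV hsm
    (AlgPoints.map π P') hPV
  rw [AlgPoints.pt_map] at h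
  have e := ringKrullDim_eq_of_ringEquiv (asIso (π.left.stalkMap P'.pt)).commRingCatIsoToRingEquiv
  rw [h, h'] at e
  exact_mod_cast e.symm

/-- **`Π(L)` is a bijection over an open set over which `Π` is an isomorphism.** [folklore] -/
theorem bijOn_map_of_isIso_morphismRestrict {L : Type} [Field L] [Algebra ℝ L] (π : X' ⟶ X)
    (O : X.left.Opens) [IsIso (π.left ∣_ O)] :
    Set.BijOn (AlgPoints.map π : AlgPoints X' L → AlgPoints X L)
      {P' | P'.pt ∈ π.left ⁻¹ᵁ O} {Q | Q.pt ∈ O} := by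
  -- the inverse over `O`: lift to `O`, apply `(π ∣_ O)⁻¹`, include into `X'`
  have hrange : ∀ Q : AlgPoints X L, Q.pt ∈ O → Set.range Q.toSpecHom ⊆ Set.range O.ι := by
    rintro Q hQ _ ⟨y, rfl⟩
    obtain rfl : y = IsLocalRing.closedPoint L := Subsingleton.elim _ _
    rw [Scheme.Opens.range_ι]
    exact hQ
  let linv : ∀ Q : AlgPoints X L, Q.pt ∈ O → (Spec (.of L) ⟶ X'.left) := fun Q hQ =>
    IsOpenImmersion.lift O.ι Q.toSpecHom (hrange Q hQ) ≫ inv (π.left ∣_ O) ≫ (π.left ⁻¹ᵁ O).ι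
  have hlinv : ∀ Q hQ, linv Q hQ ≫ π.left = Q.toSpecHom := by
    intro Q hQ
    simp only [linv, Category.assoc]
    rw [← morphismRestrict_ι, IsIso.inv_hom_id_assoc, IsOpenImmersion.lift_fac]
  let Pinv : ∀ Q : AlgPoints X L, Q.pt ∈ O → AlgPoints X' L := fun Q hQ =>
    AlgPoints.mk (linv Q hQ) (by
      rw [← Over.w π]
      change linv Q hQ ≫ π.left ≫ X.hom = _
      rw [← Category.assoc, hlinv Q hQ]
      exact Over.w Q)
  have hmapinv : ∀ Q hQ, AlgPoints.map π (Pinv Q hQ) = Q := by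
    intro Q hQ
    ext : 1
    simp only [AlgPoints.map, Pinv, Over.comp_left, Over.homMk_left]
    exact hlinv Q hQ
  refine ⟨fun P' hP' => hP', ?_, ?_⟩
  · -- injectivity
    intro P₁ h₁ P₂ h₂ h12
    have hr : ∀ P : AlgPoints X' L, P.pt ∈ π.left ⁻¹ᵁ O →
        Set.range P.toSpecHom ⊆ Set.range (π.left ⁻¹ᵁ O).ι := by
      rintro P hP _ ⟨y, rfl⟩
      obtain rfl : y = IsLocalRing.closedPoint L := Subsingleton.elim _ _
      rw [Scheme.Opens.range_ι]
      exact hP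
    set l₁ := IsOpenImmersion.lift (π.left ⁻¹ᵁ O).ι P₁.toSpecHom (hr P₁ h₁) with hl₁
    set l₂ := IsOpenImmersion.lift (π.left ⁻¹ᵁ O).ι P₂.toSpecHom (hr P₂ h₂) with hl₂
    have e₁ : l₁ ≫ (π.left ⁻¹ᵁ O).ι = P₁.toSpecHom := IsOpenImmersion.lift_fac _ _ _
    have e₂ : l₂ ≫ (π.left ⁻¹ᵁ O).ι = P₂.toSpecHom := IsOpenImmersion.lift_fac _ _ _
    have h12' : P₁.toSpecHom ≫ π.left = P₂.toSpecHom ≫ π.left := by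
      have := congrArg (fun P : AlgPoints X L => P.left) h12
      simp only [AlgPoints.map, Over.comp_left] at this
      exact this
    have key : l₁ ≫ (π.left ∣_ O) ≫ O.ι = l₂ ≫ (π.left ∣_ O) ≫ O.ι := by
      rw [morphismRestrict_ι, ← Category.assoc, e₁, ← Category.assoc, e₂]
      exact h12'
    rw [← Category.assoc, ← Category.assoc, cancel_mono, cancel_mono] at key
    ext : 1
    change P₁.toSpecHom = P₂.toSpecHom
    rw [← e₁, ← e₂, key]
  · -- surjectivity
    intro Q hQ
    have hQ' : Q.pt ∈ O := hQ
    refine ⟨Pinv Q hQ', ?_, hmapinv Q hQ'⟩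
    change (Pinv Q hQ').pt ∈ π.left ⁻¹ᵁ O
    have : (AlgPoints.map π (Pinv Q hQ')).pt ∈ O := by rw [hmapinv Q hQ']; exact hQ'
    exact this

/-- Points of a basic open of a pulled-back section. [folklore] -/
theorem mem_basicOpen_appLE_iff (π : X' ⟶ X) {U : X.left.Opens} {U' : X'.left.Opens}
    (hle : U' ≤ π.left ⁻¹ᵁ U) (s : Γ(X.left, U)) (q : X'.left) :
    q ∈ X'.left.basicOpen (π.left.appLE U U' hle s) ↔ q ∈ U' ∧ π.left q ∈ X.left.basicOpen s := by
  rw [Scheme.basicOpen_appLE]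
  rfl

end Preliminaries

/-! ### Charts: coordinates of an analytic algebraic chart are local coordinates; `Π(ℝ)` is `C^ω` -/

section Charts

variable {X X' : SchemeOver ℝ} {n n' : ℕ}

/-- **The coordinates of an analytic algebraic chart are local coordinates at every point of its
source**: if `e` has regular coordinates `x₁, …, xₙ ∈ Γ(X, U₁)` and regular functions are
analytic in `e`, then at `Q ∈ e.source` the functions `xᵢ - xᵢ(Q)` span `𝔪_Q` modulo `𝔪_Q²`
(compare differentials: `da = ∑ λᵢ dxᵢ` forces `a - ∑ λᵢ (xᵢ - xᵢ(Q)) ∈ 𝔪_Q²` by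
`RealPoints.mem_sq_of_fderiv_chart_eq_zero`, the embedding dimension being algebraic).
[cite: SerreGAGA1956, §2 n°6 Cor. 2] -/
theorem htspan_chart_coords [SmoothOfRelativeDimension n X.hom]
    (e : OpenPartialHomeomorph (AlgPoints X ℝ) (Fin n → ℝ)) {Q : AlgPoints X ℝ} (hQ : Q ∈ e.source)
    (hol : ∀ (U : X.left.affineOpens) (s : Γ(X.left, ↑U)),
      AnalyticOnNhd ℝ (evalOrZero ↑U s ∘ e.symm)
        (e.target ∩ e.symm ⁻¹' {P | P.pt ∈ (↑U : X.left.Opens)}))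
    (U₁ : X.left.affineOpens) (x : Fin n → Γ(X.left, ↑U₁))
    (hsrc : e.source ⊆ {P | P.pt ∈ (↑U₁ : X.left.Opens)})
    (hx : ∀ P ∈ e.source, ∀ i, e P i = evalOrZero ↑U₁ (x i) P) :
    ∀ a ∈ RingHom.ker (Q.evalRingHom ↑U₁ (hsrc hQ)), ∃ coef : Fin n → ℝ,
      a - ∑ i, SchemeOver.scalarRingHom X ↑U₁ (coef i) *
        (x i - SchemeOver.scalarRingHom X ↑U₁ (Q.eval ↑U₁ (hsrc hQ) (x i))) ∈
        RingHom.ker (Q.evalRingHom ↑U₁ (hsrc hQ)) ^ 2 := by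
  classical
  have hU₁ : Q.pt ∈ (↑U₁ : X.left.Opens) := hsrc hQ
  obtain ⟨Ut, hQUt, hle, t, -, htspan⟩ := exists_localCoordinates_le n Q ↑U₁ hU₁
  have alg : ∃ (U₁' : X.left.affineOpens) (x' : Fin n → Γ(X.left, ↑U₁')),
      e.source ⊆ {P | P.pt ∈ (↑U₁' : X.left.Opens)} ∧
        ∀ P ∈ e.source, ∀ i, e P i = evalOrZero ↑U₁' (x' i) P := ⟨U₁, x, hsrc, hx⟩
  intro a ha
  set κ := SchemeOver.scalarRingHom X (↑U₁ : X.left.Opens) with hκ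
  set lam : Fin n → ℝ := fun i => fderiv ℝ (evalOrZero ↑U₁ a ∘ e.symm) (e Q) (Pi.single i 1)
    with hlam
  refine ⟨lam, ?_⟩
  set b := a - ∑ i, κ (lam i) * (x i - κ (Q.eval ↑U₁ hU₁ (x i))) with hb
  -- `b ∈ 𝔪_Q`
  have hxc : ∀ i, x i - κ (Q.eval ↑U₁ hU₁ (x i)) ∈ RingHom.ker (Q.evalRingHom ↑U₁ hU₁) := fun i => by
    rw [RingHom.mem_ker, map_sub, AlgPoints.evalRingHom_apply, AlgPoints.evalRingHom_apply,
      AlgPoints.eval_scalarRingHom, sub_eq_zero]; rfl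
  have hbker : b ∈ RingHom.ker (Q.evalRingHom ↑U₁ hU₁) :=
    Ideal.sub_mem _ ha (Ideal.sum_mem _ fun i _ => Ideal.mul_mem_left _ _ (hxc i))
  -- `db = 0`
  have hdx : ∀ i, fderiv ℝ (evalOrZero ↑U₁ (x i - κ (Q.eval ↑U₁ hU₁ (x i))) ∘ e.symm) (e Q) =
      ContinuousLinearMap.proj i := fun i => by
    rw [sub_eq_add_neg, ← map_neg, fderiv_chart_add e hQ hol U₁ hU₁,
      fderiv_chart_scalarRingHom e hQ U₁ hU₁, add_zero, fderiv_chart_coord e hQ U₁ x hx i]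
  have hdb : fderiv ℝ (evalOrZero ↑U₁ b ∘ e.symm) (e Q) = 0 := by
    rw [hb, sub_eq_add_neg, fderiv_chart_add e hQ hol U₁ hU₁, ← Finset.sum_neg_distrib,
      fderiv_chart_sum e hQ hol U₁ hU₁]
    have : ∀ i, fderiv ℝ (evalOrZero ↑U₁ (-(κ (lam i) * (x i - κ (Q.eval ↑U₁ hU₁ (x i))))) ∘ e.symm)
        (e Q) = -(lam i • (ContinuousLinearMap.proj i : (Fin n → ℝ) →L[ℝ] ℝ)) := fun i => by
      rw [neg_mul_eq_neg_mul, ← map_neg, fderiv_chart_smul e hQ hol U₁ hU₁, hdx i]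
      exact neg_smul (lam i) (ContinuousLinearMap.proj i : (Fin n → ℝ) →L[ℝ] ℝ)
    simp only [this, Finset.sum_neg_distrib]
    rw [← sub_eq_add_neg, sub_eq_zero]
    ext v
    rw [FunLike.coe_sum, Finset.sum_apply]
    simp only [FunLike.coe_smul, Pi.smul_apply, ContinuousLinearMap.proj_apply, smul_eq_mul, hlam]
    have hw := dual_apply_eq_sum (fderiv ℝ (evalOrZero ↑U₁ a ∘ e.symm) (e Q)).toLinearMap v
    simp only [ContinuousLinearMap.coe_coe] at hw
    rw [hw]
    refine Finset.sum_congr rfl fun i _ => mul_comm _ _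
  -- restrict to `Ut`: still in the kernel, still zero differential
  set b' := X.left.presheaf.map (homOfLE hle).op b with hb'
  have hb'ker : b' ∈ RingHom.ker (Q.evalRingHom ↑Ut hQUt) := by
    rw [RingHom.mem_ker, AlgPoints.evalRingHom_apply, hb', AlgPoints.eval_map_homOfLE hle b hQUt]
    exact hbker
  have hdb' : fderiv ℝ (evalOrZero ↑Ut b' ∘ e.symm) (e Q) = 0 := by
    have heq : evalOrZero ↑Ut b' ∘ e.symm =ᶠ[𝓝 (e Q)] evalOrZero ↑U₁ b ∘ e.symm := by
      filter_upwards [chart_nhds e hQ hQUt] with w hw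
      simp only [Function.comp_apply, hb']
      exact AlgPoints.evalOrZero_map_homOfLE hle b hw.2
    rw [heq.fderiv_eq, hdb]
  have hsq := mem_sq_of_fderiv_chart_eq_zero e hQ hol Ut hQUt t htspan alg hb'ker hdb'
  -- back to `U₁` through the local ring
  refine mem_sq_ker_of_germ_mem_sq Q U₁ hU₁ ?_
  have hgerm : (X.left.presheaf.germ ↑U₁ Q.pt hU₁).hom b = (X.left.presheaf.germ ↑Ut Q.pt hQUt).hom b' := by
    rw [hb']
    exact (TopCat.Presheaf.germ_res_apply X.left.presheaf (homOfLE hle) Q.pt hQUt b).symm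
  rw [hgerm]
  have hle_m : Ideal.map (X.left.presheaf.germ ↑Ut Q.pt hQUt).hom (RingHom.ker (Q.evalRingHom ↑Ut hQUt)) ≤
      maximalIdeal (X.left.presheaf.stalk Q.pt) := by
    rw [Ideal.map_le_iff_le_comap]
    intro y hy
    rw [Ideal.mem_comap, ← eval_eq_zero_iff_germ_mem_maximalIdeal]
    rwa [RingHom.mem_ker, AlgPoints.evalRingHom_apply] at hy
  have := Ideal.mem_map_of_mem (X.left.presheaf.germ ↑Ut Q.pt hQUt).hom hsq
  rw [Ideal.map_pow] at this
  exact Ideal.pow_right_mono hle_m 2 this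

/-- **`Π(ℝ) : X'(ℝ) → X(ℝ)` is real-analytic** for the manifold structures of
`RealPointsManifold.exists_chartedSpace_isManifold` (in the charts, its components are the
regular functions `Π^* xᵢ` read in an analytic algebraic chart). [folklore] -/
theorem contMDiff_map (π : X' ⟶ X)
    (chart : AlgPoints X ℝ → OpenPartialHomeomorph (AlgPoints X ℝ) (Fin n → ℝ))
    [cs : ChartedSpace (Fin n → ℝ) (AlgPoints X ℝ)]
    (hchart : ∀ P, chartAt (Fin n → ℝ) P = chart P) (mem : ∀ P, P ∈ (chart P).source)
    (alg : ∀ P, ∃ (U₁ : X.left.affineOpens) (x : Fin n → Γ(X.left, ↑U₁)),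
      (chart P).source ⊆ {Q | Q.pt ∈ (↑U₁ : X.left.Opens)} ∧
        ∀ Q ∈ (chart P).source, ∀ i, chart P Q i = evalOrZero ↑U₁ (x i) Q)
    (chart' : AlgPoints X' ℝ → OpenPartialHomeomorph (AlgPoints X' ℝ) (Fin n' → ℝ))
    [cs' : ChartedSpace (Fin n' → ℝ) (AlgPoints X' ℝ)]
    (hchart' : ∀ P, chartAt (Fin n' → ℝ) P = chart' P) (mem' : ∀ P, P ∈ (chart' P).source)
    (hol' : ∀ P (U : X'.left.affineOpens) (s : Γ(X'.left, ↑U)),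
      AnalyticOnNhd ℝ (evalOrZero ↑U s ∘ (chart' P).symm)
        ((chart' P).target ∩ (chart' P).symm ⁻¹' {Q | Q.pt ∈ (↑U : X'.left.Opens)})) :
    ContMDiff 𝓘(ℝ, Fin n' → ℝ) 𝓘(ℝ, Fin n → ℝ) ω
      (AlgPoints.map π : AlgPoints X' ℝ → AlgPoints X ℝ) := by
  intro P'
  rw [contMDiffAt_iff]
  refine ⟨(AlgPoints.continuous_map π).continuousAt, ?_⟩
  simp only [extChartAt, OpenPartialHomeomorph.extend, modelWithCornersSelf_partialEquiv,
    PartialEquiv.trans_refl, modelWithCornersSelf_coe, Set.range_id,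
    OpenPartialHomeomorph.coe_toPartialEquiv_symm, OpenPartialHomeomorph.coe_toPartialEquiv,
    hchart, hchart']
  refine ContDiffAt.contDiffWithinAt ?_
  set e := chart (AlgPoints.map π P') with he
  set e' := chart' P' with he'
  obtain ⟨U₁, x, hsrc, hx⟩ := alg (AlgPoints.map π P')
  have hπP' : (AlgPoints.map π P').pt ∈ (↑U₁ : X.left.Opens) := hsrc (mem _)
  obtain ⟨U'', hU'', hP'U'', hU''le⟩ := exists_isAffineOpen_mem_and_subset
    (show P'.pt ∈ π.left ⁻¹ᵁ (↑U₁ : X.left.Opens) from hπP')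
  have hle'' : U'' ≤ π.left ⁻¹ᵁ (↑U₁ : X.left.Opens) := hU''le
  -- the neighbourhood where the chart expression is given by `Π^* xᵢ`
  have hcont : ContinuousAt (AlgPoints.map π ∘ e'.symm) (e' P') :=
    ((AlgPoints.continuous_map π).continuousAt).comp (e'.continuousAt_symm (e'.map_source (mem' P')))
  have hev : ∀ᶠ w in 𝓝 (e' P'), (w ∈ e'.target ∧ (e'.symm w).pt ∈ U'') ∧
      AlgPoints.map π (e'.symm w) ∈ e.source := by
    filter_upwards [chart_nhds e' (mem' P') hP'U'', hcont.preimage_mem_nhds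
      (e.open_source.mem_nhds (by
        simp only [Function.comp_apply, e'.left_inv (mem' P')]; exact mem _))] with w hw hw'
    exact ⟨hw, hw'⟩
  have heq : (e ∘ AlgPoints.map π ∘ e'.symm) =ᶠ[𝓝 (e' P')]
      fun w i => evalOrZero U'' (π.left.appLE ↑U₁ U'' hle'' (x i)) (e'.symm w) := by
    filter_upwards [hev] with w hw
    funext i
    simp only [Function.comp_apply]
    rw [hx _ hw.2 i, evalOrZero_appLE' π hle'' _ hw.1.2]
  refine ContDiffAt.congr_of_eventuallyEq ?_ heq
  refine (AnalyticAt.pi fun i => ?_).contDiffAt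
  have hmem : e' P' ∈ e'.target ∩ e'.symm ⁻¹' {Q : AlgPoints X' ℝ | Q.pt ∈ U''} :=
    ⟨e'.map_source (mem' P'), by
      simp only [Set.mem_preimage, Set.mem_setOf_eq, e'.left_inv (mem' P')]; exact hP'U''⟩
  have := hol' P' ⟨U'', hU''⟩ (π.left.appLE ↑U₁ U'' hle'' (x i)) (e' P') (by rw [← he']; exact hmem)
  rw [← he'] at this
  exact this

end Charts

/-! ### The manifold of real points with its maximal analytic atlas -/

section MaxAtlas

variable (X : SchemeOver ℝ) (n : ℕ) [SmoothOfRelativeDimension n X.hom]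

/-- The real-analytic manifold `X(ℝ)` of `RealPointsManifold.exists_chartedSpace_isManifold`,
re-based on its **maximal** analytic atlas (same charts `chart P` at each point, same maximal
atlas; now every compatible chart is a member of the atlas, so that restrictions of compatible
charts to open subsets are charts of the open submanifold, Mathlib
`StructureGroupoid.subtypeRestr_mem_maximalAtlas`). [cite: BochnakCosteRoy1998, Prop. 3.3.11] -/
theorem exists_chartedSpace_isManifold_max :
    ∃ (chart : AlgPoints X ℝ → OpenPartialHomeomorph (AlgPoints X ℝ) (Fin n → ℝ))
      (cs : ChartedSpace (Fin n → ℝ) (AlgPoints X ℝ))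
      (_ : @IsManifold ℝ _ _ _ _ _ _ 𝓘(ℝ, Fin n → ℝ) ω (AlgPoints X ℝ) _ cs),
      (∀ P, @chartAt (Fin n → ℝ) _ (AlgPoints X ℝ) _ cs P = chart P) ∧
      (∀ φ, φ ∈ @IsManifold.maximalAtlas ℝ _ _ _ _ _ _ 𝓘(ℝ, Fin n → ℝ) ω (AlgPoints X ℝ) _ cs →
        φ ∈ @atlas (Fin n → ℝ) _ (AlgPoints X ℝ) _ cs) ∧
      (∀ P, P ∈ (chart P).source) ∧
      (∀ P, ∃ (U : X.left.affineOpens) (x : Fin n → Γ(X.left, ↑U)),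
        (chart P).source ⊆ {Q | Q.pt ∈ (↑U : X.left.Opens)} ∧
        ∀ Q ∈ (chart P).source, ∀ i, chart P Q i = evalOrZero ↑U (x i) Q) ∧
      (∀ P (U : X.left.affineOpens) (s : Γ(X.left, ↑U)),
        AnalyticOnNhd ℝ (evalOrZero ↑U s ∘ (chart P).symm)
          ((chart P).target ∩ (chart P).symm ⁻¹' {Q | Q.pt ∈ (↑U : X.left.Opens)})) := by
  obtain ⟨chart, cs₀, hM₀, hchart, -, mem, alg, hol⟩ := exists_chartedSpace_isManifold X n
  -- the maximal atlas of the original structure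
  let A : Set (OpenPartialHomeomorph (AlgPoints X ℝ) (Fin n → ℝ)) :=
    @IsManifold.maximalAtlas ℝ _ _ _ _ _ _ 𝓘(ℝ, Fin n → ℝ) ω (AlgPoints X ℝ) _ cs₀
  have hAchart : ∀ P, chart P ∈ A := fun P => by
    rw [← hchart P]
    exact @IsManifold.chart_mem_maximalAtlas ℝ _ _ _ _ _ _ 𝓘(ℝ, Fin n → ℝ) ω (AlgPoints X ℝ) _ cs₀
      hM₀ P
  have hAcompat : ∀ e e' : OpenPartialHomeomorph (AlgPoints X ℝ) (Fin n → ℝ), e ∈ A → e' ∈ A →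
      e.symm ≫ₕ e' ∈ contDiffGroupoid ω 𝓘(ℝ, Fin n → ℝ) := fun e e' he he' =>
    @StructureGroupoid.compatible_of_mem_maximalAtlas _ _ _ _ cs₀ _ _ _ he he'
  let cs : ChartedSpace (Fin n → ℝ) (AlgPoints X ℝ) :=
    { atlas := A
      chartAt := chart
      mem_chart_source := mem
      chart_mem_atlas := hAchart }
  have hM : @IsManifold ℝ _ _ _ _ _ _ 𝓘(ℝ, Fin n → ℝ) ω (AlgPoints X ℝ) _ cs := by
    letI := cs
    refine isManifold_of_contDiffOn _ _ _ fun e e' he he' => ?_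
    exact (mem_groupoid_of_pregroupoid.mp (hAcompat e e' he he')).1
  refine ⟨chart, cs, hM, fun P => rfl, ?_, mem, alg, hol⟩
  intro φ hφ
  -- `φ` is compatible with every chart of `A ⊇ atlas cs₀`, hence lies in `A`
  change φ ∈ A
  intro e' he'
  have he'A : e' ∈ A := @StructureGroupoid.subset_maximalAtlas _ _ _ _ cs₀ _ _ _ he'
  exact hφ e' he'A

end MaxAtlas

/-! ### The resolution data -/

section Main

variable {X : SchemeOver ℝ}

/-- Nonvanishing of the value of a section at a real point, in terms of its basic open.
[folklore] -/
theorem eval_ne_zero_iff_mem_basicOpen (Q : AlgPoints X ℝ) (U : X.left.affineOpens)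
    (hQ : Q.pt ∈ (↑U : X.left.Opens)) (a : Γ(X.left, ↑U)) :
    Q.eval ↑U hQ a ≠ 0 ↔ Q.pt ∈ X.left.basicOpen a := by
  rw [mem_basicOpen_iff_not_mem_primeIdealOf U hQ a, ← ker_evalRingHom_eq_primeIdealOf Q U hQ,
    RingHom.mem_ker, AlgPoints.evalRingHom_apply]

/-- Relative dimensions of smooth integral `ℝ`-schemes related by a morphism which is an
isomorphism over a non-empty open agree (both are the common dimension).
[cite: GortzWedhorn2020, Thm. 5.22 (3)] -/
theorem eq_of_isIso_morphismRestrict {W W' : Scheme.{0}} (f : W ⟶ Spec (.of ℝ))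
    [LocallyOfFiniteType f] [IsIntegral W] [IsIntegral W'] (π : W' ⟶ W)
    [LocallyOfFiniteType (π ≫ f)] (O : W.Opens) (hO : (O : Set W).Nonempty) [IsIso (π ∣_ O)]
    {d d' : ℕ} [SmoothOfRelativeDimension d f] [SmoothOfRelativeDimension d' (π ≫ f)] :
    d' = d := by
  have hO' : ((π ⁻¹ᵁ O : W'.Opens) : Set W').Nonempty := by
    obtain ⟨x, hx⟩ := hO
    obtain ⟨y, hy⟩ := (inferInstance : IsIso (π ∣_ O)).1
    haveI : Nonempty (↑(π ⁻¹ᵁ O) : Scheme) := ⟨(inv (π ∣_ O)) ⟨x, hx⟩⟩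
    obtain ⟨z⟩ := (inferInstance : Nonempty (↑(π ⁻¹ᵁ O) : Scheme))
    exact ⟨z.1, z.2⟩
  have h1 := topologicalKrullDim_opens_eq (π ≫ f) (π ⁻¹ᵁ O) hO'
  have h2 := topologicalKrullDim_opens_eq f O hO
  have h3 := IsHomeomorph.topologicalKrullDim_eq _ (Scheme.homeoOfIso (asIso (π ∣_ O))).isHomeomorph
  have hd := Literature.AlgebraicGeometry.Motives.topologicalKrullDim_eq_of_smoothOfRelativeDimension f d
  have hd' := Literature.AlgebraicGeometry.Motives.topologicalKrullDim_eq_of_smoothOfRelativeDimension (π ≫ f) d'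
  rw [hd] at h2
  rw [hd'] at h1
  rw [h1, h2] at h3
  exact_mod_cast h3

variable {d l : ℕ} (W : SchemeOver ℝ) [SmoothOfRelativeDimension d W.hom] [IsSeparated W.hom]
    [LocallyOfFiniteType W.hom] [QuasiCompact W.hom] [IsIntegral W.left]

omit [IsSeparated W.hom] [LocallyOfFiniteType W.hom] [QuasiCompact W.hom] [IsIntegral W.left] in
/-- **Local monomial charts** for the resolution: the heart of `exists_resolutionData`, isolated.
Given `π : X' → W` over `ℝ` with `X'` smooth of relative dimension `d`, an isomorphism off
`Z = ⋃ᵢ {sᵢ = 0}`, with `π⁻¹ Z` a simple normal crossings divisor, the analytic chart `e` of `W(ℝ)`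
and a point `p` of the open subset `M = π(ℝ)⁻¹(O₀)` of `X'(ℝ)`, `O₀ ⊆ e.source ∩ U(ℝ)`, lying
over `Z`: there
is a chart of the maximal analytic atlas of `M` centred at `p` in which all `sᵢ ∘ π` and the
Jacobian determinant of `e ∘ π(ℝ)` are `(nonvanishing analytic) · monomial`.
[cite: ArnoldGuseinzadeVarchenko2012, Part II §7.3, proof of Thm. 7.5] -/
theorem exists_monomialChart {X' : SchemeOver ℝ} [SmoothOfRelativeDimension d X'.hom]
    (π : X' ⟶ W)
    (chart : AlgPoints W ℝ → OpenPartialHomeomorph (AlgPoints W ℝ) (Fin d → ℝ))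
    [ChartedSpace (Fin d → ℝ) (AlgPoints W ℝ)] [IsManifold 𝓘(ℝ, Fin d → ℝ) ω (AlgPoints W ℝ)]
    (alg : ∀ P, ∃ (U₁ : W.left.affineOpens) (x : Fin d → Γ(W.left, ↑U₁)),
      (chart P).source ⊆ {Q | Q.pt ∈ (↑U₁ : W.left.Opens)} ∧
        ∀ Q ∈ (chart P).source, ∀ i, chart P Q i = evalOrZero ↑U₁ (x i) Q)
    (hol : ∀ P (U : W.left.affineOpens) (s : Γ(W.left, ↑U)),
      AnalyticOnNhd ℝ (evalOrZero ↑U s ∘ (chart P).symm)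
        ((chart P).target ∩ (chart P).symm ⁻¹' {Q | Q.pt ∈ (↑U : W.left.Opens)}))
    (chart' : AlgPoints X' ℝ → OpenPartialHomeomorph (AlgPoints X' ℝ) (Fin d → ℝ))
    [cs' : ChartedSpace (Fin d → ℝ) (AlgPoints X' ℝ)] [IsManifold 𝓘(ℝ, Fin d → ℝ) ω (AlgPoints X' ℝ)]
    (hchart' : ∀ P, chartAt (Fin d → ℝ) P = chart' P)
    (hmax' : ∀ φ, φ ∈ IsManifold.maximalAtlas 𝓘(ℝ, Fin d → ℝ) ω (AlgPoints X' ℝ) →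
      φ ∈ atlas (Fin d → ℝ) (AlgPoints X' ℝ))
    (mem' : ∀ P, P ∈ (chart' P).source)
    (alg' : ∀ P, ∃ (U₁ : X'.left.affineOpens) (x : Fin d → Γ(X'.left, ↑U₁)),
      (chart' P).source ⊆ {Q | Q.pt ∈ (↑U₁ : X'.left.Opens)} ∧
        ∀ Q ∈ (chart' P).source, ∀ i, chart' P Q i = evalOrZero ↑U₁ (x i) Q)
    (hol' : ∀ P (U : X'.left.affineOpens) (s : Γ(X'.left, ↑U)),
      AnalyticOnNhd ℝ (evalOrZero ↑U s ∘ (chart' P).symm)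
        ((chart' P).target ∩ (chart' P).symm ⁻¹' {Q | Q.pt ∈ (↑U : X'.left.Opens)}))
    (Q₀ : AlgPoints W ℝ) (U : W.left.affineOpens) (s : Fin l → Γ(W.left, ↑U))
    (hZc : IsClosed {w : W.left | ∃ i, w ∉ W.left.basicOpen (s i)})
    [IsIso (π.left ∣_ ⟨{w : W.left | ∃ i, w ∉ W.left.basicOpen (s i)}ᶜ, hZc.isOpen_compl⟩)]
    (E : List X'.left.IdealSheafData) (hsnc : HasSNC E)
    (hpre : (π.left : X'.left → W.left) ⁻¹' {w : W.left | ∃ i, w ∉ W.left.basicOpen (s i)} =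
      ⋃ D ∈ E, (D.support : Set X'.left))
    (O₀ : Set (AlgPoints W ℝ)) (hO₀ : O₀ ⊆ (chart Q₀).source ∩ {Q | Q.pt ∈ (↑U : W.left.Opens)})
    (hMo : IsOpen ((AlgPoints.map π : AlgPoints X' ℝ → AlgPoints W ℝ) ⁻¹' O₀))
    (p : (⟨_, hMo⟩ : TopologicalSpace.Opens (AlgPoints X' ℝ)))
    (hp : ∃ i, (AlgPoints.map π p.1).pt ∉ W.left.basicOpen (s i)) :
    ∃ φ ∈ IsManifold.maximalAtlas 𝓘(ℝ, Fin d → ℝ) ω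
        (⟨_, hMo⟩ : TopologicalSpace.Opens (AlgPoints X' ℝ)),
      p ∈ φ.source ∧ φ p = 0 ∧
      ∃ (k : Fin l → Fin d → ℕ) (h : Fin d → ℕ) (a : Fin l → (Fin d → ℝ) → ℝ) (b : (Fin d → ℝ) → ℝ),
        (∀ i, AnalyticOnNhd ℝ (a i) φ.target) ∧ AnalyticOnNhd ℝ b φ.target ∧
        (∀ i, ∀ u ∈ φ.target, a i u ≠ 0) ∧ (∀ u ∈ φ.target, b u ≠ 0) ∧
        (∀ i, ∀ u ∈ φ.target, evalOrZero ↑U (s i) ((chart Q₀).symm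
            ((chart Q₀) (AlgPoints.map π (φ.symm u).1))) = a i u * ∏ j, u j ^ k i j) ∧
        (∀ u ∈ φ.target, (fderiv ℝ (fun v => (chart Q₀) (AlgPoints.map π (φ.symm v).1)) u).det =
            b u * ∏ j, u j ^ h j) := by
  classical
  obtain ⟨i₀, hi₀⟩ := hp
  set e := chart Q₀ with he
  let Mo : TopologicalSpace.Opens (AlgPoints X' ℝ) := ⟨_, hMo⟩
  set P' : AlgPoints X' ℝ := p.1 with hP'
  have hpM : AlgPoints.map π P' ∈ e.source ∩ {Q | Q.pt ∈ (↑U : W.left.Opens)} := hO₀ p.2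
  set Q : AlgPoints W ℝ := AlgPoints.map π P' with hQdef
  set x' : X'.left := P'.pt with hx'
  set Z : Set W.left := {w | ∃ i, w ∉ W.left.basicOpen (s i)} with hZ
  have hQZ : Q.pt ∈ Z := ⟨i₀, hi₀⟩
  -- divisors through a point of `π⁻¹ Z` specialising to `x'` pass through `x'`
  have hZS_aux : ∀ q : X'.left, q ⤳ x' → (π.left : X'.left → W.left) q ∈ Z →
      ∃ D ∈ E, q ∈ D.support ∧ x' ∈ D.support := by
    intro q hqx hqZ
    have : q ∈ (π.left : X'.left → W.left) ⁻¹' Z := hqZ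
    rw [hpre, Set.mem_iUnion₂] at this
    obtain ⟨D, hDE, hqD⟩ := this
    exact ⟨D, hDE, hqD, hqx.mem_closed D.support.isClosed hqD⟩
  -- A. the snc data at `x'`, reindexed by `Fin d`
  obtain ⟨hreg, u, huspan, ⟨ι, hιinj, hDu⟩, -⟩ := hsnc x'
  haveI : IsDomain (X'.left.presheaf.stalk x') := isDomain_of_isRegularLocalRing _
  have hm : (maximalIdeal (X'.left.presheaf.stalk x')).spanFinrank = d :=
    spanFinrank_maximalIdeal_stalk_eq P' hreg
  set uu : Fin d → X'.left.presheaf.stalk x' := fun j => u (Fin.cast hm.symm j) with huu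
  set ιι : {D // D ∈ E ∧ x' ∈ D.support} → Fin d := fun D => Fin.cast hm (ι D) with hιι
  have huuspan : Ideal.span (Set.range uu) = maximalIdeal _ := by
    rw [← huspan]
    congr 1
    ext z
    constructor
    · rintro ⟨j, rfl⟩; exact ⟨Fin.cast hm.symm j, rfl⟩
    · rintro ⟨j, rfl⟩
      refine ⟨Fin.cast hm j, ?_⟩
      simp [huu]
  have hDuu : ∀ D, stalkIdeal D.1 x' = Ideal.span {uu (ιι D)} := fun D => by
    rw [hDu D]
    simp [huu, hιι]
  -- B1. coordinates downstairs: those of `e`, on an affine `W₁ ∋ Q` carrying the basis `dxᵢ`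
  obtain ⟨U_e, x_e, hsrc, hx_e⟩ := alg Q₀
  have hQsrc : Q ∈ e.source := hpM.1
  have hQU : Q.pt ∈ (↑U : W.left.Opens) := hpM.2
  have hQUe : Q.pt ∈ (↑U_e : W.left.Opens) := hsrc hQsrc
  have htspan_e := htspan_chart_coords e hQsrc (hol Q₀) U_e x_e hsrc hx_e
  set κe := SchemeOver.scalarRingHom W (↑U_e : W.left.Opens) with hκe
  set xs : Fin d → Γ(W.left, ↑U_e) := fun i => x_e i - κe (Q.eval ↑U_e hQUe (x_e i)) with hxs
  obtain ⟨W₁, hQW₁, hle₁, hW₁U, bU, hbU⟩ :=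
    exists_affineOpen_basis_kaehler U_e hQUe xs htspan_e (↑U) hQU
  set x : Fin d → Γ(W.left, ↑W₁) := fun i => W.left.presheaf.map (homOfLE hle₁).op (x_e i)
    with hxdef
  have hbUx : ∀ i, bU i = KaehlerDifferential.D ℝ Γ(W.left, ↑W₁) (x i) := by
    intro i
    rw [hbU i]
    simp only [hxs, map_sub, hxdef]
    rw [map_scalarRingHom hle₁, ← UniversalHyperplaneSection.algebraMap_sections,
      Derivation.map_algebraMap, sub_zero]
  -- the chart `ξ = e` restricted to `W₁(ℝ)`
  set ξ := e.restrOpen {P | P.pt ∈ (↑W₁ : W.left.Opens)} (AlgPoints.isOpen_setOf_pt_mem _) with hξ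
  have hξsrc : ξ.source = e.source ∩ {P | P.pt ∈ (↑W₁ : W.left.Opens)} := e.restrOpen_source _ _
  have hξx : ∀ P ∈ ξ.source, ∀ i, ξ P i = evalOrZero ↑W₁ (x i) P := by
    intro P hP i
    rw [hξsrc] at hP
    change e P i = _
    rw [hx_e P hP.1 i, hxdef, AlgPoints.evalOrZero_map_homOfLE hle₁ (x_e i) hP.2]
  have hQξ : Q ∈ ξ.source := by rw [hξsrc]; exact ⟨hQsrc, hQW₁⟩
  -- B2. sections upstairs realising the parameters, on an affine `U' ∋ x'` over `W₁` with basis `dt'ⱼ`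
  have hx'W₁ : x' ∈ π.left ⁻¹ᵁ (↑W₁ : W.left.Opens) := hQW₁
  obtain ⟨U'₀, hU'₀, hx'U'₀, hU'₀le⟩ := exists_isAffineOpen_mem_and_subset hx'W₁
  obtain ⟨t'₀, ht'₀assoc, ht'₀span, ht'₀0, ht'₀span2⟩ :=
    exists_sections_of_span_eq_maximalIdeal P' uu huuspan ⟨U'₀, hU'₀⟩ hx'U'₀
  obtain ⟨U', hx'U', hle', -, bU', hbU'⟩ :=
    exists_affineOpen_basis_kaehler ⟨U'₀, hU'₀⟩ hx'U'₀ t'₀ ht'₀span2 U'₀ hx'U'₀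
  set t' : Fin d → Γ(X'.left, ↑U') := fun j => X'.left.presheaf.map (homOfLE hle').op (t'₀ j)
    with ht'def
  have hbU't : ∀ j, bU' j = KaehlerDifferential.D ℝ Γ(X'.left, ↑U') (t' j) := hbU'
  have hgerm_t' : ∀ j, (X'.left.presheaf.germ ↑U' x' hx'U').hom (t' j) =
      (X'.left.presheaf.germ (↑(⟨U'₀, hU'₀⟩ : X'.left.affineOpens)) x' hx'U'₀).hom (t'₀ j) := fun j =>
    TopCat.Presheaf.germ_res_apply X'.left.presheaf (homOfLE hle') x' hx'U' (t'₀ j)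
  have ht'span : Ideal.span (Set.range fun j => (X'.left.presheaf.germ ↑U' x' hx'U').hom (t' j)) =
      maximalIdeal _ := by
    simp_rw [hgerm_t']; exact ht'₀span
  have ht'0 : ∀ j, t' j ∈ RingHom.ker (P'.evalRingHom ↑U' hx'U') := fun j => by
    rw [RingHom.mem_ker, AlgPoints.evalRingHom_apply, ht'def, AlgPoints.eval_map_homOfLE hle' _ hx'U']
    exact ht'₀0 j
  have ht'span2 := htspan_of_le P' ⟨U'₀, hU'₀⟩ U' hle' hx'U'₀ hx'U' t'₀ ht'₀span2
  have hDt' : ∀ D : {D // D ∈ E ∧ x' ∈ D.support},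
      stalkIdeal D.1 x' = Ideal.span {(X'.left.presheaf.germ ↑U' x' hx'U').hom (t' (ιι D))} := by
    intro D
    rw [hDuu D, hgerm_t']
    exact Ideal.span_singleton_eq_span_singleton.2 (ht'₀assoc (ιι D))
  have hleW₁ : (↑U' : X'.left.Opens) ≤ π.left ⁻¹ᵁ ↑W₁ := fun q hq => hU'₀le (hle' hq)
  have hleU : (↑U' : X'.left.Opens) ≤ π.left ⁻¹ᵁ ↑U := fun q hq => hW₁U (hleW₁ hq)
  -- C. the monomial normal forms
  set S : Set (Fin d) := Set.range ιι with hS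
  have Hgen : ∀ (q : X'.left) (hq : q ∈ (↑U' : X'.left.Opens)), q ⤳ x' →
      (π.left : X'.left → W.left) q ∈ Z → ∃ j ∈ S, t' j ∈ (U'.2.primeIdealOf ⟨q, hq⟩).asIdeal := by
    intro q hq hqx hqZ
    obtain ⟨D, hDE, hqD, hx'D⟩ := hZS_aux q hqx hqZ
    exact ⟨ιι ⟨D, hDE, hx'D⟩, ⟨_, rfl⟩, mem_primeIdealOf_of_mem_support_of_stalkIdeal_eq U' hx'U'
      hq hqx D hqD (t' _) (hDt' ⟨D, hDE, hx'D⟩)⟩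
  -- C-f: the pulled-back functions
  set σ : Fin l → Γ(X'.left, ↑U') := fun i => π.left.appLE ↑U ↑U' hleU (s i) with hσ
  have Hσ : ∀ i (q : X'.left) (hq : q ∈ (↑U' : X'.left.Opens)), q ⤳ x' →
      q ∉ X'.left.basicOpen (σ i) → ∃ j ∈ S, t' j ∈ (U'.2.primeIdealOf ⟨q, hq⟩).asIdeal := by
    intro i q hq hqx hqσ
    refine Hgen q hq hqx ?_
    rw [hσ, mem_basicOpen_appLE_iff] at hqσ
    exact ⟨i, fun hh => hqσ ⟨hq, hh⟩⟩
  have hfin : (maximalIdeal (X'.left.presheaf.stalk P'.pt)).spanFinrank = d := hm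
  choose k num den hkS hnum hden hfac using fun i =>
    exists_mul_eq_mul_prod_pow P' U' hx'U' hreg t' ht'span hfin (σ i) S (Hσ i)
  -- C-J: the Jacobian determinant
  set Jsec : Γ(X'.left, ↑U') := Matrix.det (Matrix.of fun i j =>
    bU'.repr (KaehlerDifferential.D ℝ Γ(X'.left, ↑U') (π.left.appLE ↑W₁ ↑U' hleW₁ (x i))) j)
    with hJsec
  have HJ : ∀ (q : X'.left) (hq : q ∈ (↑U' : X'.left.Opens)), q ⤳ x' →
      q ∉ X'.left.basicOpen Jsec → ∃ j ∈ S, t' j ∈ (U'.2.primeIdealOf ⟨q, hq⟩).asIdeal := by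
    intro q hq hqx hqJ
    refine Hgen q hq hqx ?_
    by_contra hqZ
    haveI : IsIso (π.left.stalkMap q) :=
      isIso_stalkMap_of_isIso_morphismRestrict π.left ⟨Zᶜ, hZc.isOpen_compl⟩ q hqZ
    exact hqJ (mem_basicOpen_det_of_isIso_stalkMap π W₁ U' hleW₁ x bU hbUx bU' q hq)
  obtain ⟨h, numJ, denJ, hhS, hnumJ, hdenJ, hfacJ⟩ :=
    exists_mul_eq_mul_prod_pow P' U' hx'U' hreg t' ht'span hfin Jsec S HJ
  -- D. the chart: centred at `P'`, coordinates `t'`, inside the locus where all units are units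
  set B : X'.left.Opens := X'.left.basicOpen ((∏ i, (num i * den i)) * (numJ * denJ)) with hB
  have hBle : B ≤ ↑U' := X'.left.basicOpen_le _
  have hBval : ∀ P : AlgPoints X' ℝ, P.pt ∈ B → ∃ hP : P.pt ∈ (↑U' : X'.left.Opens),
      (∀ i, P.eval ↑U' hP (num i) ≠ 0 ∧ P.eval ↑U' hP (den i) ≠ 0) ∧
        P.eval ↑U' hP numJ ≠ 0 ∧ P.eval ↑U' hP denJ ≠ 0 := by
    intro P hPB
    refine ⟨hBle hPB, ?_⟩
    have hv := (eval_ne_zero_iff_mem_basicOpen P U' (hBle hPB) _).2 hPB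
    rw [← AlgPoints.evalRingHom_apply, map_mul, map_mul, map_prod] at hv
    simp only [map_mul] at hv
    obtain ⟨h1, h2⟩ := mul_ne_zero_iff.1 hv
    refine ⟨fun i => ?_, mul_ne_zero_iff.1 h2⟩
    have := (Finset.prod_ne_zero_iff.1 h1) i (Finset.mem_univ i)
    exact mul_ne_zero_iff.1 this
  have hP'B : P'.pt ∈ B := by
    rw [hB, ← eval_ne_zero_iff_mem_basicOpen P' U' hx'U', ← AlgPoints.evalRingHom_apply, map_mul,
      map_mul, map_prod]
    simp only [map_mul, AlgPoints.evalRingHom_apply]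
    refine mul_ne_zero (Finset.prod_ne_zero_iff.2 fun i _ => mul_ne_zero (hnum i) (hden i))
      (mul_ne_zero hnumJ hdenJ)
  set O' : Set (AlgPoints X' ℝ) := (Mo : Set (AlgPoints X' ℝ)) ∩
    (AlgPoints.map π) ⁻¹' ξ.source ∩ {P | P.pt ∈ B} with hO'
  have hO'o : IsOpen O' :=
    (Mo.2.inter (ξ.open_source.preimage (AlgPoints.continuous_map π))).inter
      (AlgPoints.isOpen_setOf_pt_mem _)
  have hP'O' : P' ∈ O' := ⟨⟨p.2, hQξ⟩, hP'B⟩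
  obtain ⟨φ', hφ'atlas, hP'φ', hφ'0, hφ'src, hφ't, holφ'⟩ :=
    exists_centredChart chart' hchart' mem' alg' hol' U' hx'U' t' ht'0 ht'span2 hO'o hP'O'
  have hφ'U' : φ'.source ⊆ {P | P.pt ∈ (↑U' : X'.left.Opens)} := fun P hP => (hφ'src hP).2
  -- its restriction to the open subset `Mo`
  haveI : Nonempty Mo := ⟨p⟩
  set φ := φ'.subtypeRestr (s := Mo) ⟨p⟩ with hφdef
  have hφmax : φ ∈ IsManifold.maximalAtlas 𝓘(ℝ, Fin d → ℝ) ω Mo :=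
    StructureGroupoid.subtypeRestr_mem_maximalAtlas (hmax' φ' hφ'atlas) ⟨p⟩
  -- bookkeeping on `φ.target`
  have htgt : ∀ u ∈ φ.target, u ∈ φ'.target ∧ (φ.symm u).1 = φ'.symm u := fun u hu =>
    ⟨φ'.subtypeRestr_target_subset ⟨p⟩ hu, φ'.subtypeRestr_symm_apply ⟨p⟩ hu⟩
  have hsrc' : ∀ u ∈ φ.target, φ'.symm u ∈ φ'.source ∧ φ'.symm u ∈ O' ∧ φ' (φ'.symm u) = u :=
    fun u hu => ⟨φ'.map_target (htgt u hu).1, (hφ'src (φ'.map_target (htgt u hu).1)).1,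
      φ'.right_inv (htgt u hu).1⟩
  have hcoord : ∀ u (hu : u ∈ φ.target) j,
      (φ'.symm u).eval ↑U' (hφ'U' (hsrc' u hu).1) (t' j) = u j := by
    intro u hu j
    rw [← evalOrZero_of_mem, ← hφ't _ (hsrc' u hu).1 j, (hsrc' u hu).2.2]
  -- the analytic units
  refine ⟨φ, hφmax, by rw [hφdef, OpenPartialHomeomorph.subtypeRestr_source]; exact hP'φ',
    by rw [hφdef, OpenPartialHomeomorph.subtypeRestr_coe]; exact hφ'0, k, h,
    fun i u => evalOrZero ↑U' (num i) (φ'.symm u) / evalOrZero ↑U' (den i) (φ'.symm u),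
    fun u => evalOrZero ↑U' numJ (φ'.symm u) / evalOrZero ↑U' denJ (φ'.symm u),
    ?_, ?_, ?_, ?_, ?_, ?_⟩
  · -- analyticity of the `aᵢ`
    intro i u hu
    have hmem : u ∈ φ'.target ∩ φ'.symm ⁻¹' {P | P.pt ∈ (↑U' : X'.left.Opens)} :=
      ⟨(htgt u hu).1, hφ'U' (hsrc' u hu).1⟩
    obtain ⟨hPU', hvals, -, -⟩ := hBval _ (hsrc' u hu).2.1.2
    refine (holφ' U' (num i) u hmem).div (holφ' U' (den i) u hmem) ?_
    simp only [evalOrZero_of_mem _ hPU']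
    exact (hvals i).2
  · intro u hu
    have hmem : u ∈ φ'.target ∩ φ'.symm ⁻¹' {P | P.pt ∈ (↑U' : X'.left.Opens)} :=
      ⟨(htgt u hu).1, hφ'U' (hsrc' u hu).1⟩
    obtain ⟨hPU', -, -, hvJ⟩ := hBval _ (hsrc' u hu).2.1.2
    refine (holφ' U' numJ u hmem).div (holφ' U' denJ u hmem) ?_
    simp only [evalOrZero_of_mem _ hPU']
    exact hvJ
  · intro i u hu
    beta_reduce
    obtain ⟨hPU', hvals, -, -⟩ := hBval _ (hsrc' u hu).2.1.2
    rw [evalOrZero_of_mem _ hPU', evalOrZero_of_mem _ hPU']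
    exact div_ne_zero (hvals i).1 (hvals i).2
  · intro u hu
    beta_reduce
    obtain ⟨hPU', -, hvJ1, hvJ2⟩ := hBval _ (hsrc' u hu).2.1.2
    rw [evalOrZero_of_mem _ hPU', evalOrZero_of_mem _ hPU']
    exact div_ne_zero hvJ1 hvJ2
  · -- the normal form of `sᵢ ∘ π`
    intro i u hu
    beta_reduce
    obtain ⟨hPU', hvals, -, -⟩ := hBval _ (hsrc' u hu).2.1.2
    have hπsrc : AlgPoints.map π (φ'.symm u) ∈ e.source := (hO₀ (hsrc' u hu).2.1.1.1).1
    rw [(htgt u hu).2, e.left_inv hπsrc, ← evalOrZero_appLE' π hleU (φ'.symm u) hPU' (s i),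
      evalOrZero_of_mem _ hPU', evalOrZero_of_mem _ hPU', evalOrZero_of_mem _ hPU']
    have key := eval_mul_eq_of_mul_eq (hfac i) (φ'.symm u) hPU'
    simp only [hcoord u hu] at key
    rw [div_mul_eq_mul_div, eq_div_iff (hvals i).2, key]
  · -- the Jacobian determinant
    intro u hu
    beta_reduce
    obtain ⟨hPU', -, hvJ1, hvJ2⟩ := hBval _ (hsrc' u hu).2.1.2
    have hπξ : AlgPoints.map π (φ'.symm u) ∈ ξ.source := (hsrc' u hu).2.1.1.2
    -- the map agrees with `ξ ∘ π(ℝ) ∘ φ'⁻¹` near `u`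
    have heq : (fun v => (chart Q₀) (AlgPoints.map π (φ.symm v).1)) =ᶠ[𝓝 u]
        (ξ ∘ AlgPoints.map π ∘ φ'.symm) := by
      filter_upwards [φ.open_target.mem_nhds hu] with v hv
      simp only [Function.comp_apply, (htgt v hv).2]
      rfl
    obtain ⟨hQu, -, hφ'u⟩ := hsrc' u hu
    have hdet := det_fderiv_chart_map_eq_eval π W₁ U' hleW₁ x t' bU' hbU't φ' holφ' hφ'U' hφ't ξ
      hξx hQu hπξ
    rw [hφ'u] at hdet
    rw [heq.fderiv_eq, hdet]
    have key := eval_mul_eq_of_mul_eq hfacJ (φ'.symm u) hPU'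
    simp only [hcoord u hu] at key
    rw [evalOrZero_of_mem _ hPU', evalOrZero_of_mem _ hPU', div_mul_eq_mul_div, eq_div_iff hvJ2]
    exact key

/-- **Resolution data on the real points (Hironaka's theorem in the form used for asymptotics
of Laplace integrals, for regular functions on a smooth real variety).** See the module
docstring. The open set of `ℝᵈ` is `V = e.target ∩ e⁻¹(U(ℝ)) ∩ O` for the analytic algebraic chart
`e = chart Q₀` and an arbitrary open `O ⊆ ℝᵈ`, the functions are `Fᵢ = sᵢ ∘ e⁻¹`; the conclusion
lists: `g(M) ⊆ V`, `g` is
`C^ω`, `g` is proper over `V`, `g` is a bijection from `{∀ i, Fᵢ ∘ g ≠ 0}` onto `{∀ i, Fᵢ ≠ 0}`,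
and the local monomial normal forms at the points of `M` over the zero set.
[cite: ArnoldGuseinzadeVarchenko2012, Part II §7.3, proof of Thm. 7.5; Kollar2007, Thm. 3.21] -/
theorem exists_resolutionData
    (chart : AlgPoints W ℝ → OpenPartialHomeomorph (AlgPoints W ℝ) (Fin d → ℝ))
    [cs : ChartedSpace (Fin d → ℝ) (AlgPoints W ℝ)] [IsManifold 𝓘(ℝ, Fin d → ℝ) ω (AlgPoints W ℝ)]
    (hchart : ∀ P, chartAt (Fin d → ℝ) P = chart P) (mem : ∀ P, P ∈ (chart P).source)
    (alg : ∀ P, ∃ (U₁ : W.left.affineOpens) (x : Fin d → Γ(W.left, ↑U₁)),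
      (chart P).source ⊆ {Q | Q.pt ∈ (↑U₁ : W.left.Opens)} ∧
        ∀ Q ∈ (chart P).source, ∀ i, chart P Q i = evalOrZero ↑U₁ (x i) Q)
    (hol : ∀ P (U : W.left.affineOpens) (s : Γ(W.left, ↑U)),
      AnalyticOnNhd ℝ (evalOrZero ↑U s ∘ (chart P).symm)
        ((chart P).target ∩ (chart P).symm ⁻¹' {Q | Q.pt ∈ (↑U : W.left.Opens)}))
    (Q₀ : AlgPoints W ℝ) (U : W.left.affineOpens) (hU : Q₀.pt ∈ (↑U : W.left.Opens))
    (s : Fin l → Γ(W.left, ↑U)) (hs : ∀ i, s i ≠ 0) (O : Set (Fin d → ℝ)) (hO : IsOpen O) :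
    ∃ (M : Type) (_ : TopologicalSpace M) (_ : T2Space M) (_ : ChartedSpace (Fin d → ℝ) M)
      (_ : IsManifold 𝓘(ℝ, Fin d → ℝ) ω M) (g : M → (Fin d → ℝ)),
      (∀ p, g p ∈ (chart Q₀).target ∩ (chart Q₀).symm ⁻¹' {Q | Q.pt ∈ (↑U : W.left.Opens)} ∩ O) ∧
      ContMDiff 𝓘(ℝ, Fin d → ℝ) 𝓘(ℝ, Fin d → ℝ) ω g ∧
      (∀ K ⊆ (chart Q₀).target ∩ (chart Q₀).symm ⁻¹' {Q | Q.pt ∈ (↑U : W.left.Opens)} ∩ O,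
        IsCompact K → IsCompact (g ⁻¹' K)) ∧
      Set.BijOn g {p | ∀ i, evalOrZero ↑U (s i) ((chart Q₀).symm (g p)) ≠ 0}
        {v ∈ (chart Q₀).target ∩ (chart Q₀).symm ⁻¹' {Q | Q.pt ∈ (↑U : W.left.Opens)} ∩ O |
          ∀ i, evalOrZero ↑U (s i) ((chart Q₀).symm v) ≠ 0} ∧
      ∀ p, (∃ i, evalOrZero ↑U (s i) ((chart Q₀).symm (g p)) = 0) →
        ∃ φ ∈ IsManifold.maximalAtlas 𝓘(ℝ, Fin d → ℝ) ω M, p ∈ φ.source ∧ φ p = 0 ∧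
          ∃ (k : Fin l → Fin d → ℕ) (h : Fin d → ℕ) (a : Fin l → (Fin d → ℝ) → ℝ)
            (b : (Fin d → ℝ) → ℝ),
            (∀ i, AnalyticOnNhd ℝ (a i) φ.target) ∧ AnalyticOnNhd ℝ b φ.target ∧
            (∀ i, ∀ u ∈ φ.target, a i u ≠ 0) ∧ (∀ u ∈ φ.target, b u ≠ 0) ∧
            (∀ i, ∀ u ∈ φ.target,
              evalOrZero ↑U (s i) ((chart Q₀).symm (g (φ.symm u))) = a i u * ∏ j, u j ^ k i j) ∧
            (∀ u ∈ φ.target, (fderiv ℝ (g ∘ φ.symm) u).det = b u * ∏ j, u j ^ h j) := by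
  classical
  set e := chart Q₀ with he_def
  -- the closed set to resolve
  set Z : Set W.left := {w | ∃ i, w ∉ W.left.basicOpen (s i)} with hZ
  have hZc : IsClosed Z := by
    have : Z = ⋃ i, ((W.left.basicOpen (s i) : Set W.left))ᶜ := by
      ext w; simp [hZ]
    rw [this]
    exact isClosed_iUnion_of_finite fun i => (W.left.basicOpen (s i)).2.isClosed_compl
  have hZne : Z ≠ Set.univ := by
    haveI : Nonempty (↑U : W.left.Opens) := ⟨⟨Q₀.pt, hU⟩⟩
    have hprod : (∏ i, s i) ≠ 0 := Finset.prod_ne_zero_iff.2 fun i _ => hs i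
    have hne : ((W.left.basicOpen (∏ i, s i) : W.left.Opens) : Set W.left).Nonempty := by
      by_contra h
      rw [Set.not_nonempty_iff_eq_empty, TopologicalSpace.Opens.coe_eq_empty,
        AlgebraicGeometry.basicOpen_eq_bot_iff] at h
      exact hprod h
    obtain ⟨w, hw⟩ := hne
    intro hZu
    have hwZ : w ∈ Z := hZu ▸ Set.mem_univ w
    obtain ⟨i, hi⟩ := hwZ
    have hwU : w ∈ (↑U : W.left.Opens) := W.left.basicOpen_le _ hw
    rw [SetLike.mem_coe, Scheme.mem_basicOpen _ _ w hwU, map_prod, IsUnit.prod_iff] at hw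
    exact hi ((Scheme.mem_basicOpen _ _ w hwU).2 (hw i (Finset.mem_univ i)))
  -- Hironaka: log resolution of `Z ⊂ W`
  have hreg : Scheme.IsRegular W.left := by
    letI : W.left.Over (Spec (.of ℝ)) := ⟨W.hom⟩
    haveI : Smooth (W.left ↘ Spec (.of ℝ)) := SmoothOfRelativeDimension.smooth d W.hom
    exact Scheme.isRegular_of_smooth_over_field ℝ W.left
  obtain ⟨W', ϖ, E, hprop, hint', hreg', hiso, hsnc, hpre⟩ :=
    exists_logResolution_of_isClosed W.hom hreg hZc hZne
  haveI := hprop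
  haveI := hint'
  let X' : SchemeOver ℝ := Over.mk (ϖ ≫ W.hom)
  let π : X' ⟶ W := Over.homMk ϖ rfl
  have hπ : π.left = ϖ := rfl
  haveI : LocallyOfFiniteType X'.hom := by
    change LocallyOfFiniteType (ϖ ≫ W.hom); infer_instance
  haveI : IsSeparated X'.hom := by
    change IsSeparated (ϖ ≫ W.hom); infer_instance
  haveI hint'' : IsIntegral X'.left := hint'
  obtain ⟨d', hd'⟩ := exists_smoothOfRelativeDimension_of_isRegular (ϖ ≫ W.hom) hreg'
  have hOne : ((⟨Zᶜ, hZc.isOpen_compl⟩ : W.left.Opens) : Set W.left).Nonempty :=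
    Set.nonempty_compl.2 hZne
  obtain rfl : d' = d := by
    haveI := hd'
    haveI := hiso
    exact eq_of_isIso_morphismRestrict W.hom ϖ ⟨Zᶜ, hZc.isOpen_compl⟩ hOne
  haveI : SmoothOfRelativeDimension d' X'.hom := hd'
  -- the manifold `X'(ℝ)` with its maximal analytic atlas
  obtain ⟨chart', cs', hM', hchart', hmax', mem', alg', hol'⟩ :=
    exists_chartedSpace_isManifold_max X' d'
  haveI := hM'
  haveI : T2Space (AlgPoints X' ℝ) := t2Space_algPoints_real X'
  -- the open submanifold `M = π(ℝ)⁻¹(e.source ∩ U(ℝ))` and `g = e ∘ π(ℝ)`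
  set O₀ : Set (AlgPoints W ℝ) := e.source ∩ {Q | Q.pt ∈ (↑U : W.left.Opens)} ∩ e ⁻¹' O with hO₀
  have hO₀sub : O₀ ⊆ e.source ∩ {Q | Q.pt ∈ (↑U : W.left.Opens)} := Set.inter_subset_left
  have hO₀o : IsOpen O₀ := by
    have : O₀ = (e.source ∩ e ⁻¹' O) ∩ {Q | Q.pt ∈ (↑U : W.left.Opens)} := by
      rw [hO₀]; ext Q; simp only [Set.mem_inter_iff, Set.mem_preimage, Set.mem_setOf_eq]; tauto
    rw [this]
    exact (e.continuousOn.isOpen_inter_preimage e.open_source hO).inter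
      (AlgPoints.isOpen_setOf_pt_mem _)
  have hMo : IsOpen ((AlgPoints.map π : AlgPoints X' ℝ → AlgPoints W ℝ) ⁻¹' O₀) :=
    hO₀o.preimage (AlgPoints.continuous_map π)
  let Mo : TopologicalSpace.Opens (AlgPoints X' ℝ) := ⟨_, hMo⟩
  let g : Mo → (Fin d' → ℝ) := fun p => e (AlgPoints.map π p.1)
  have hval : ∀ p : Mo, AlgPoints.map π p.1 ∈ O₀ := fun p => p.2
  -- values of the `Fᵢ ∘ g`
  have hF : ∀ (p : Mo) i, evalOrZero ↑U (s i) (e.symm (g p)) =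
      (AlgPoints.map π p.1).eval ↑U (hval p).1.2 (s i) := fun p i => by
    simp only [g, e.left_inv (hval p).1.1]
    exact evalOrZero_of_mem _ _
  have hFne : ∀ p : Mo, (∀ i, evalOrZero ↑U (s i) (e.symm (g p)) ≠ 0) ↔
      (AlgPoints.map π p.1).pt ∉ Z := fun p => by
    simp only [hF, hZ, Set.mem_setOf_eq, not_exists, not_not]
    exact forall_congr' fun i => eval_ne_zero_iff_mem_basicOpen _ U (hval p).1.2 (s i)
  have hgV : ∀ p : Mo, g p ∈ e.target ∩ e.symm ⁻¹' {Q | Q.pt ∈ (↑U : W.left.Opens)} ∩ O := by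
    intro p
    refine ⟨⟨e.map_source (hval p).1.1, ?_⟩, (hval p).2⟩
    simp only [Set.mem_preimage, Set.mem_setOf_eq, g, e.left_inv (hval p).1.1]
    exact (hval p).1.2
  refine ⟨Mo, inferInstance, inferInstance, inferInstance, inferInstance, g, hgV, ?_, ?_, ?_, ?_⟩
  · -- `g` is real-analytic
    have h1 : ContMDiff 𝓘(ℝ, Fin d' → ℝ) 𝓘(ℝ, Fin d' → ℝ) ω
        (AlgPoints.map π : AlgPoints X' ℝ → AlgPoints W ℝ) :=
      contMDiff_map π chart hchart mem alg chart' hchart' mem' hol'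
    have h2 : ContMDiff 𝓘(ℝ, Fin d' → ℝ) 𝓘(ℝ, Fin d' → ℝ) ω (Subtype.val : Mo → AlgPoints X' ℝ) :=
      contMDiff_subtype_val
    have h3 : ContMDiffOn 𝓘(ℝ, Fin d' → ℝ) 𝓘(ℝ, Fin d' → ℝ) ω e e.source := by
      rw [he_def, ← hchart Q₀]; exact contMDiffOn_chart
    exact h3.comp_contMDiff (h1.comp h2) fun p => (hval p).1.1
  · -- `g` is proper over `V`
    intro K hK hKc
    have hK' : IsCompact (e.symm '' K) :=
      hKc.image_of_continuousOn (e.continuousOn_symm.mono fun v hv => (hK hv).1.1)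
    have hK'sub : e.symm '' K ⊆ O₀ := by
      rintro _ ⟨v, hv, rfl⟩
      refine ⟨⟨e.map_target (hK hv).1.1, (hK hv).1.2⟩, ?_⟩
      show e (e.symm v) ∈ O
      rw [e.right_inv (hK hv).1.1]; exact (hK hv).2
    haveI : UniversallyClosed π.left := hprop.toUniversallyClosed
    haveI : QuasiCompact π.left := inferInstance
    have hc : IsCompact ((AlgPoints.map π) ⁻¹' (e.symm '' K)) := AlgPoints.isCompact_preimage_map π hK'
    have hEq : g ⁻¹' K = Subtype.val ⁻¹' ((AlgPoints.map π) ⁻¹' (e.symm '' K)) := by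
      ext p
      simp only [Set.mem_preimage, g]
      constructor
      · intro h
        exact ⟨e (AlgPoints.map π p.1), h, e.left_inv (hval p).1.1⟩
      · rintro ⟨v, hv, hv'⟩
        have : e (AlgPoints.map π p.1) = v := by rw [← hv', e.right_inv (hK hv).1.1]
        rw [this]; exact hv
    rw [hEq, Topology.IsEmbedding.subtypeVal.isCompact_iff, Set.image_preimage_eq_inter_range,
      Subtype.range_val]
    have hsub : (AlgPoints.map π) ⁻¹' (e.symm '' K) ⊆ (Mo : Set (AlgPoints X' ℝ)) :=
      fun P hP => hK'sub hP
    rwa [Set.inter_eq_left.2 hsub]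
  · -- bijective off the zero sets
    haveI : IsIso (π.left ∣_ ⟨Zᶜ, hZc.isOpen_compl⟩) := hiso
    have hbij := bijOn_map_of_isIso_morphismRestrict (L := ℝ) π ⟨Zᶜ, hZc.isOpen_compl⟩
    refine ⟨?_, ?_, ?_⟩
    · intro p hp
      exact ⟨hgV p, hp⟩
    · intro p hp p' hp' hpp'
      have h1 : AlgPoints.map π p.1 = AlgPoints.map π p'.1 :=
        e.injOn (hval p).1.1 (hval p').1.1 hpp'
      have hpZ : (AlgPoints.map π p.1).pt ∉ Z := (hFne p).1 hp
      have hp'Z : (AlgPoints.map π p'.1).pt ∉ Z := (hFne p').1 hp'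
      have := hbij.injOn
        (show p.1.pt ∈ π.left ⁻¹ᵁ (⟨Zᶜ, hZc.isOpen_compl⟩ : W.left.Opens) from hpZ)
        (show p'.1.pt ∈ π.left ⁻¹ᵁ (⟨Zᶜ, hZc.isOpen_compl⟩ : W.left.Opens) from hp'Z) h1
      exact Subtype.ext this
    · intro v hv
      obtain ⟨⟨⟨hvt, hvU⟩, hvO⟩, hvF⟩ := hv
      set Q := e.symm v with hQ
      have hQsrc : Q ∈ e.source := e.map_target hvt
      have hQZ : Q.pt ∉ Z := by
        simp only [hZ, Set.mem_setOf_eq, not_exists, not_not]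
        intro i
        have := hvF i
        rw [evalOrZero_of_mem _ (show (e.symm v).pt ∈ (↑U : W.left.Opens) from hvU)] at this
        exact (eval_ne_zero_iff_mem_basicOpen _ U hvU (s i)).1 this
      obtain ⟨P', hP', hP'Q⟩ := hbij.surjOn (show Q ∈ {Q : AlgPoints W ℝ | Q.pt ∈
        (⟨Zᶜ, hZc.isOpen_compl⟩ : W.left.Opens)} from hQZ)
      have hP'M : P' ∈ Mo := by
        change AlgPoints.map π P' ∈ O₀
        rw [hP'Q]
        refine ⟨⟨hQsrc, hvU⟩, ?_⟩
        show e Q ∈ O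
        rw [hQ, e.right_inv hvt]; exact hvO
      refine ⟨⟨P', hP'M⟩, ?_, ?_⟩
      · change ∀ i, evalOrZero ↑U (s i) (e.symm (e (AlgPoints.map π P'))) ≠ 0
        rw [hP'Q, e.left_inv hQsrc]
        exact hvF
      · change e (AlgPoints.map π P') = v
        rw [hP'Q, hQ, e.right_inv hvt]
  · -- local monomial charts over the zero set
    intro p hp
    have hp' : ∃ i, (AlgPoints.map π p.1).pt ∉ W.left.basicOpen (s i) := by
      obtain ⟨i, hi⟩ := hp
      refine ⟨i, fun hmem => ?_⟩
      rw [hF p i] at hi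
      exact ((eval_ne_zero_iff_mem_basicOpen _ U (hval p).1.2 (s i)).2 hmem) hi
    haveI : IsIso (π.left ∣_ ⟨{w : W.left | ∃ i, w ∉ W.left.basicOpen (s i)}ᶜ, hZc.isOpen_compl⟩) :=
      hiso
    obtain ⟨φ, hφ, hpφ, hφ0, k, h, a, b, ha, hb, ha0, hb0, hFa, hJb⟩ :=
      exists_monomialChart W π chart alg hol chart' hchart' hmax' mem' alg' hol' Q₀ U s
        hZc E hsnc hpre O₀ hO₀sub hMo p hp'
    exact ⟨φ, hφ, hpφ, hφ0, k, h, a, b, ha, hb, ha0, hb0, hFa, hJb⟩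

end Main

end RealPoints

end Literature.AlgebraicGeometry.RealAlgebraic

end
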